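import Literature.Probability.LatticeModels.GKSInequalities
import HarnessLib

/-!
# Freezing bound for spin products: `⟨σ_A⟩ ≤ ∏_{a ∈ A₁} tanh k_a`

A consequence of the GKS "freezing" inequality
`Literature.Probability.LatticeModels.gksExpect_le_frozen` (Friedli–Velenik 2017, Exercise 3.12:
freezing spins to `+1` raises the correlations of a ferromagnetic `±1` system
`ν_{Λ;K} ∝ exp (∑ᵢ Kᵢ ω_{Cᵢ})`, `Kᵢ ≥ 0`): if `A₁ ⊆ A` is a set of sites such that **every interaction
set `Cᵢ` contains at most one site of `A₁`**, then freezing all spins outside `A₁` leaves a system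
of *independent* spins `(ω_a)_{a ∈ A₁}` with single-site weights `exp (k_a ω_a)`,
`k_a = ∑_{i : a ∈ Cᵢ} Kᵢ` (`siteCoupling`), whence

`⟨σ_A⟩_{Λ;K} ≤ ∏_{a ∈ A₁} tanh k_a` (`gksExpect_spinProduct_le_prod_tanh`).

This is the mechanism of S. Chatterjee, *Wilson loops in Ising lattice gauge theory*, Comm. Math.
Phys. 377 (2020), proof of Lemma 7.2 (arXiv:1811.09770, §7): for `ℤ₂` lattice gauge theory
(spins on edges, `Cₚ` = the four edges of the plaquette `p`, `Kₚ = β`) and a loop `γ = A` whose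
non-corner edges `A₁ = γ₁` pairwise share no plaquette, "under this conditioning,
`(σ_e)_{e ∈ γ₁}` are independent spins" and `|μ'(σ_e)| ≤ tanh 6β`, giving
`|⟨W_γ⟩| ≤ (tanh 6β)^{ℓ - ℓ₀}`. Chatterjee conditions on the outside spins under the
infinite-volume measure; the GKS freezing inequality gives the same upper bound in every finite
volume with ferromagnetic couplings (torus, free or plus boundary conditions), which is the form
needed to transfer it to infinite-volume limit points. Everything here is proved; no named fact.

## References

* S. Friedli, Y. Velenik, *Statistical Mechanics of Lattice Systems* (CUP 2017), §3.8.1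
  Thm. 3.49 (GKS), Exercise 3.12 (freezing). [FriedliVelenik2017]
* S. Chatterjee, Comm. Math. Phys. 377 (2020) 307–340, arXiv:1811.09770, Lemma 7.2 and the step
  `W⁵ → W⁶` of Lemma 7.1. [arXiv181109770]
-/

noncomputable section

open Finset

namespace Literature.Probability.LatticeModels

variable {Λ ι : Type*}

/-! ### Sums over the two spin values -/

/-- `∑_{u = ±1} e^{k u} = e^{k} + e^{-k}`. [folklore] -/
theorem sum_units_exp_mul (k : ℝ) :
    ∑ u : ℤˣ, Real.exp (k * ((u : ℤ) : ℝ)) = Real.exp k + Real.exp (-k) := by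
  rw [UnitsInt.univ, Finset.sum_pair (by decide)]
  simp

/-- `∑_{u = ±1} u e^{k u} = e^{k} - e^{-k}`. [folklore] -/
theorem sum_units_mul_exp_mul (k : ℝ) :
    ∑ u : ℤˣ, ((u : ℤ) : ℝ) * Real.exp (k * ((u : ℤ) : ℝ)) = Real.exp k - Real.exp (-k) := by
  rw [UnitsInt.univ, Finset.sum_pair (by decide)]
  simp [sub_eq_add_neg]

/-! ### Configurations frozen to `+1` off a set `A₁` -/

section Frozen

variable [DecidableEq Λ] (s : Finset ι) (K : ι → ℝ) (C : ι → Finset Λ)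

/-- The total coupling `k_a = ∑_{i ∈ s, a ∈ Cᵢ} Kᵢ` through the site `a` (for `ℤ₂` lattice gauge
theory with `Kₚ = β`: `β` times the number of plaquettes containing the edge `a`, i.e. `6β` in
`ℤ⁴`; Chatterjee 2020, proof of Lemma 7.2). [cite: arXiv181109770, proof of Lemma 7.2] -/
def siteCoupling (a : Λ) : ℝ :=
  ∑ i ∈ s.filter (fun i => a ∈ C i), K i

/-- `siteCoupling` unfolded. [folklore] -/
theorem siteCoupling_def (a : Λ) :
    siteCoupling s K C a = ∑ i ∈ s.filter (fun i => a ∈ C i), K i := rfl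

omit [DecidableEq Λ] in
/-- The configurations frozen to `+1` off `A₁` are the tree's glued configurations
`glue A₁ f .plus` (`IsingModel`); off `A₁` they equal `1`. [folklore] -/
theorem glue_plus_eq_one_of_not_mem {A₁ : Finset Λ} (f : ↥A₁ → ℤˣ) {x : Λ} (hx : x ∉ A₁) :
    glue A₁ f .plus x = 1 := by
  rw [glue_apply_of_notMem _ _ _ hx]; rfl

omit [DecidableEq Λ] in
/-- A product of `±1` spins over a set with at most one element is `1 + ∑ (σ_x - 1)`. [folklore] -/
theorem prod_spinAt_eq_one_add_sum_of_card_le_one {S : Finset Λ} (hS : #S ≤ 1) (ω : SpinConfig Λ) :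
    ∏ x ∈ S, spinAt x ω = 1 + ∑ x ∈ S, (spinAt x ω - 1) := by
  rcases Nat.le_one_iff_eq_zero_or_eq_one.1 hS with h | h
  · rw [Finset.card_eq_zero.1 h]; simp
  · obtain ⟨a, rfl⟩ := Finset.card_eq_one.1 h
    simp

/-- **The frozen Hamiltonian is a sum of single-site terms.** If every interaction set meets `A₁`
in at most one site and `ω ≡ +1` off `A₁`, then
`∑ᵢ Kᵢ ω_{Cᵢ} = ∑ᵢ Kᵢ + ∑_{a ∈ A₁} k_a (ω_a - 1)` (Chatterjee 2020, proof of Lemma 7.2: the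
conditional law of `σ_e` is `∝ e^{m β σ_e}`). [cite: arXiv181109770, proof of Lemma 7.2] -/
theorem gksHamiltonian_frozen_eq {A₁ : Finset Λ} (hsep : ∀ i ∈ s, #(C i ∩ A₁) ≤ 1)
    {ω : SpinConfig Λ} (hω : ∀ x, x ∉ A₁ → ω x = 1) :
    gksHamiltonian s K C ω =
      (∑ i ∈ s, K i) + ∑ a ∈ A₁, siteCoupling s K C a * (spinAt a ω - 1) := by
  -- each interaction only sees its (at most one) site in `A₁`
  have hprod : ∀ i ∈ s, spinProduct (C i) ω = 1 + ∑ x ∈ C i ∩ A₁, (spinAt x ω - 1) := by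
    intro i hi
    rw [spinProduct, ← Finset.prod_filter_of_ne (p := fun x => x ∈ A₁)
      (fun x _ hx => by_contra fun hxA => hx (by simp [spinAt, hω x hxA])),
      Finset.filter_mem_eq_inter, prod_spinAt_eq_one_add_sum_of_card_le_one (hsep i hi)]
  calc gksHamiltonian s K C ω
      = ∑ i ∈ s, (K i + ∑ x ∈ C i ∩ A₁, K i * (spinAt x ω - 1)) := by
        refine Finset.sum_congr rfl fun i hi => ?_
        rw [hprod i hi, mul_add, mul_one, Finset.mul_sum]
    _ = (∑ i ∈ s, K i) + ∑ i ∈ s, ∑ x ∈ C i ∩ A₁, K i * (spinAt x ω - 1) :=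
        Finset.sum_add_distrib
    _ = (∑ i ∈ s, K i) + ∑ a ∈ A₁, ∑ i ∈ s.filter (fun i => a ∈ C i), K i * (spinAt a ω - 1) := by
        congr 1
        refine Finset.sum_comm' fun i x => ?_
        simp only [Finset.mem_inter, Finset.mem_filter]
        tauto
    _ = (∑ i ∈ s, K i) + ∑ a ∈ A₁, siteCoupling s K C a * (spinAt a ω - 1) := by
        simp_rw [siteCoupling, Finset.sum_mul]

/-- **Factorisation of the frozen Boltzmann weight** into single-site factors:
`e^{H(ω)} = e^{∑ Kᵢ - ∑ k_a} ∏_{a ∈ A₁} e^{k_a ω_a}` for `ω ≡ +1` off `A₁`. [folklore] -/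
theorem gksWeight_frozen_eq {A₁ : Finset Λ} (hsep : ∀ i ∈ s, #(C i ∩ A₁) ≤ 1)
    {ω : SpinConfig Λ} (hω : ∀ x, x ∉ A₁ → ω x = 1) :
    gksWeight s K C ω =
      Real.exp ((∑ i ∈ s, K i) - ∑ a ∈ A₁, siteCoupling s K C a) *
        ∏ a ∈ A₁, Real.exp (siteCoupling s K C a * spinAt a ω) := by
  rw [gksWeight, gksHamiltonian_frozen_eq s K C hsep hω, ← Real.exp_sum, ← Real.exp_add]
  congr 1
  simp_rw [mul_sub, mul_one, Finset.sum_sub_distrib]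
  ring

variable [Fintype Λ]

/-- Sums over the configurations frozen to `+1` off `A₁` are sums over assignments on `A₁`. [folklore] -/
theorem sum_filter_frozen_compl_eq (A₁ : Finset Λ) (g : SpinConfig Λ → ℝ) :
    ∑ ω ∈ univ.filter (fun ω : SpinConfig Λ => ∀ x ∈ A₁ᶜ, ω x = 1), g ω =
      ∑ f : ↥A₁ → ℤˣ, g (glue A₁ f .plus) := by
  refine Finset.sum_nbij' (fun ω a => ω a) (fun f => glue A₁ f .plus) (fun _ _ => Finset.mem_univ _)
    (fun f _ => ?_) (fun ω hω => ?_) (fun f _ => ?_) (fun ω hω => ?_)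
  · simp only [Finset.mem_filter, Finset.mem_univ, true_and, Finset.mem_compl]
    exact fun x hx => glue_plus_eq_one_of_not_mem f hx
  · simp only [Finset.mem_filter, Finset.mem_univ, true_and, Finset.mem_compl] at hω
    funext x
    by_cases hx : x ∈ A₁
    · rw [glue_apply_of_mem _ _ _ hx]
    · rw [glue_plus_eq_one_of_not_mem _ hx, hω x hx]
  · funext a
    simp
  · simp only [Finset.mem_filter, Finset.mem_univ, true_and, Finset.mem_compl] at hω
    congr 1
    funext x
    by_cases hx : x ∈ A₁
    · rw [glue_apply_of_mem _ _ _ hx]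
    · rw [glue_plus_eq_one_of_not_mem _ hx, hω x hx]

/-- The frozen partition function factorises: `∑_{ω ≡ 1 off A₁} e^{H} = e^{c} ∏_a (e^{k_a} + e^{-k_a})`. [folklore] -/
theorem sum_frozen_gksWeight_eq {A₁ : Finset Λ} (hsep : ∀ i ∈ s, #(C i ∩ A₁) ≤ 1) :
    ∑ ω ∈ univ.filter (fun ω : SpinConfig Λ => ∀ x ∈ A₁ᶜ, ω x = 1), gksWeight s K C ω =
      Real.exp ((∑ i ∈ s, K i) - ∑ a ∈ A₁, siteCoupling s K C a) *
        ∏ a ∈ A₁, (Real.exp (siteCoupling s K C a) + Real.exp (-siteCoupling s K C a)) := by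
  rw [sum_filter_frozen_compl_eq]
  have hw : ∀ f : ↥A₁ → ℤˣ, gksWeight s K C (glue A₁ f .plus) =
      Real.exp ((∑ i ∈ s, K i) - ∑ a ∈ A₁, siteCoupling s K C a) *
        ∏ a : ↥A₁, Real.exp (siteCoupling s K C a * (((f a : ℤˣ) : ℤ) : ℝ)) := by
    intro f
    rw [gksWeight_frozen_eq s K C hsep (fun x hx => glue_plus_eq_one_of_not_mem f hx),
      ← Finset.prod_coe_sort A₁]
    congr 1
    refine Finset.prod_congr rfl fun a _ => ?_
    rw [spinAt, glue_apply_of_mem _ f _ a.2]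
  simp_rw [hw, ← Finset.mul_sum]
  rw [← Finset.prod_coe_sort A₁]
  simp_rw [← sum_units_exp_mul]
  rw [Finset.prod_univ_sum, Fintype.piFinset_univ]

/-- The frozen numerator factorises:
`∑_{ω ≡ 1 off A₁} ω_A e^{H} = e^{c} ∏_a (e^{k_a} - e^{-k_a})` for `A₁ ⊆ A`. [folklore] -/
theorem sum_frozen_spinProduct_mul_gksWeight_eq {A A₁ : Finset Λ} (hA : A₁ ⊆ A)
    (hsep : ∀ i ∈ s, #(C i ∩ A₁) ≤ 1) :
    ∑ ω ∈ univ.filter (fun ω : SpinConfig Λ => ∀ x ∈ A₁ᶜ, ω x = 1),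
        spinProduct A ω * gksWeight s K C ω =
      Real.exp ((∑ i ∈ s, K i) - ∑ a ∈ A₁, siteCoupling s K C a) *
        ∏ a ∈ A₁, (Real.exp (siteCoupling s K C a) - Real.exp (-siteCoupling s K C a)) := by
  rw [sum_filter_frozen_compl_eq]
  have hw : ∀ f : ↥A₁ → ℤˣ, spinProduct A (glue A₁ f .plus) * gksWeight s K C (glue A₁ f .plus) =
      Real.exp ((∑ i ∈ s, K i) - ∑ a ∈ A₁, siteCoupling s K C a) *
        ∏ a : ↥A₁, ((((f a : ℤˣ) : ℤ) : ℝ) *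
          Real.exp (siteCoupling s K C a * (((f a : ℤˣ) : ℤ) : ℝ))) := by
    intro f
    have hsp : spinProduct A (glue A₁ f .plus) = ∏ a : ↥A₁, (((f a : ℤˣ) : ℤ) : ℝ) := by
      rw [spinProduct, ← Finset.prod_subset hA (fun x _ hx => by
        simp [spinAt, glue_plus_eq_one_of_not_mem f hx]), ← Finset.prod_coe_sort A₁]
      refine Finset.prod_congr rfl fun a _ => ?_
      rw [spinAt, glue_apply_of_mem _ f _ a.2]
    rw [hsp, gksWeight_frozen_eq s K C hsep (fun x hx => glue_plus_eq_one_of_not_mem f hx),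
      ← Finset.prod_coe_sort A₁, mul_left_comm, ← Finset.prod_mul_distrib]
    congr 1
    refine Finset.prod_congr rfl fun a _ => ?_
    rw [spinAt, glue_apply_of_mem _ f _ a.2]
  simp_rw [hw, ← Finset.mul_sum]
  rw [← Finset.prod_coe_sort A₁]
  simp_rw [← sum_units_mul_exp_mul]
  rw [Finset.prod_univ_sum, Fintype.piFinset_univ]

/-- **Freezing bound for spin products.** For a ferromagnetic system `ν_{Λ;K} ∝ exp (∑ᵢ Kᵢ ω_{Cᵢ})`,
`Kᵢ ≥ 0`, a set of sites `A` and a subset `A₁ ⊆ A` such that every interaction set `Cᵢ` contains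
at most one site of `A₁`:
`⟨σ_A⟩_{Λ;K} ≤ ∏_{a ∈ A₁} tanh k_a`, `k_a = ∑_{i : a ∈ Cᵢ} Kᵢ`.
Proof: freeze every spin outside `A₁` to `+1` (`gksExpect_le_frozen`, GKS II); the frozen system
is a product of independent spins with weights `e^{k_a ω_a}`, whose `σ_A`-average is
`∏ (e^{k_a} - e^{-k_a}) / (e^{k_a} + e^{-k_a})`. This is the finite-volume, boundary-condition-free
form of Chatterjee's bound `|μ'(W_γ)| ≤ ∏_{e ∈ γ₁} |μ'(σ_e)| ≤ (tanh 6β)^{ℓ-ℓ₀}` (CMP 377 (2020),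
proof of Lemma 7.2), where `A = γ`, `A₁ = γ₁` = the non-corner edges (no two on a common
plaquette) and `k_e = 6β`. [cite: arXiv181109770, Lemma 7.2 (proof)] -/
theorem gksExpect_spinProduct_le_prod_tanh [DecidableEq ι] (hK : ∀ i ∈ s, 0 ≤ K i)
    {A A₁ : Finset Λ} (hA : A₁ ⊆ A) (hsep : ∀ i ∈ s, #(C i ∩ A₁) ≤ 1) :
    gksExpect s K C (spinProduct A) ≤ ∏ a ∈ A₁, Real.tanh (siteCoupling s K C a) := by
  refine (gksExpect_le_frozen s K C hK A₁ᶜ A).trans (le_of_eq ?_)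
  rw [sum_frozen_spinProduct_mul_gksWeight_eq s K C hA hsep, sum_frozen_gksWeight_eq s K C hsep,
    mul_div_mul_left _ _ (Real.exp_pos _).ne', ← Finset.prod_div_distrib]
  refine Finset.prod_congr rfl fun a _ => ?_
  rw [Real.tanh_eq]

/-- The same bound with a uniform coupling: if moreover `k_a = k` for all `a ∈ A₁` then
`⟨σ_A⟩_{Λ;K} ≤ (tanh k)^{|A₁|}` (Chatterjee 2020, Lemma 7.2 with `k = 6β`, `|A₁| = ℓ - ℓ₀`).
[cite: arXiv181109770, Lemma 7.2] -/
theorem gksExpect_spinProduct_le_tanh_pow [DecidableEq ι] (hK : ∀ i ∈ s, 0 ≤ K i)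
    {A A₁ : Finset Λ} (hA : A₁ ⊆ A) (hsep : ∀ i ∈ s, #(C i ∩ A₁) ≤ 1) {k : ℝ}
    (hk : ∀ a ∈ A₁, siteCoupling s K C a = k) :
    gksExpect s K C (spinProduct A) ≤ Real.tanh k ^ #A₁ := by
  refine (gksExpect_spinProduct_le_prod_tanh s K C hK hA hsep).trans (le_of_eq ?_)
  rw [Finset.prod_congr rfl fun a ha => by rw [hk a ha], Finset.prod_const]

end Frozen

end Literature.Probability.LatticeModels
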